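import Summits.QuantumAdvantage.QuantumAdvantage.Theses.SpinorFlattening
import Summits.QuantumAdvantage.QuantumAdvantage.Theorems.SpinorFlatteningNegApproxGaussRankSuperpolyMassBound
import Summits.QuantumAdvantage.QuantumAdvantage.Theorems.SpinorFlatteningNegApproxGaussRankSuperpolyFilterCard
import Summits.QuantumAdvantage.QuantumAdvantage.Theorems.SpinorFlatteningNegApproxGaussRankSuperpolyCountGap
import Summits.QuantumAdvantage.QuantumAdvantage.Theorems.SpinorFlatteningNegApproxGaussRankSuperpolyMagicInvariant
import Summits.QuantumAdvantage.QuantumAdvantage.Theorems.SpinorFlatteningNegApproxGaussRankSuperpolyFlatOrthoOfInvariant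
import Summits.QuantumAdvantage.QuantumAdvantage.Theorems.SpinorFlatteningNegApproxGaussRankSuperpolyNormalOrder
import Literature.Computability.QuantumComplexity.GaussianRank

/-!
# Crux `SpinorFlattening.NegApproxGaussRankSuperpoly` (stmt-QuantumAdvantage-1245) — line `spectral-mass-flattening`

PROOF of the crux (lead prover, line `spectral-mass-flattening`, 2026-08-16): the sorry-free composition of the
registered skeleton `Cruxes/NegApproxGaussRankSuperpoly/Lines/spectral-mass-flattening.lean` over its six stubs,
all LANDED as separate theorem files and imported here (`…SuperpolyMassBound` p71968, `…SuperpolyFilterCard`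
p74182, `…SuperpolyCountGap` p74656, `…SuperpolyMagicInvariant` p74598, `…SuperpolyFlatOrthoOfInvariant` p74600,
`…SuperpolyNormalOrder`).  Stub map of the reshaped skeleton:

* `stub_deficiency`  ↦ `stub_normalOrder` (CAR normal ordering of ONE Gaussian state along a complement of
  its annihilator space: every degree-`K` Majorana word applied to `g` lies in the span of the SORTED
  complement words of length `≤ K` and parity `K`) + `stub_filterCard` (that index set has exactly
  `D_K(n) = flatteningDeficiency K n` elements); the `r`-term statement `deficiency` is composed below.
* `stub_flatOrthonormal` ↦ `stub_flatOrthoOfInvariant` (pure Pauli algebra: for ANY unit vector `ψ` fixed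
  by the block `X⊗X⊗X⊗X` strings and by the in-block `Z Z` pairs, the one-per-block Majorana monomial images
  `mono s ψ` are orthonormal — a SYMMETRY-SIGN argument: for `s ≠ s'` one of those strings `P` commutes with
  `mono s` and anticommutes with `mono s'` or vice versa, so `⟨mono s ψ, mono s' ψ⟩ = −⟨mono s ψ, mono s' ψ⟩`)
  + `stub_magicInvariant` (`|M⟩^{⊗t}` is such a `ψ`: closed-form computation); `flatOrthonormal` is composed below.
* `stub_massBound` — LANDED, imported.
* `stub_countGap` — unchanged.

## The crux
`∃ δ ∈ (0,1) ∀ c ∃ t ∀ r ≤ t^c + c ∀ (a : Fin r → ℂ) (g : Fin r → QReg (t*4) → ℂ), (∀ i, IsGauss (g i)) →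
δ² < normSq (M^{⊗t} − Σ aᵢ • gᵢ)` — superpolynomial constant-precision approximate Gaussian rank of the
matchgate-magic powers (the route's KILL item; the inline `maj`/`IsGauss`/`Mpow` of the Theses file are
definitionally the tree's `majorana`/`IsGaussian`/`magicMPow`).

## The line (count the MASS of the Clifford flattening, not one singular value)
Fix `t, K`. A *block pattern* `s : Fin t → Option (Fin 4 × Bool)` excites, in each four-qubit block `b` of
`|M⟩^{⊗t}`, nothing or ONE Jordan–Wigner Majorana `c_{4b+i,β}`; its monomial is the ordered product (increasing
block order) `((List.finRange t).filterMap fun b => (s b).map fun q => majorana (t*4) (finProdFinEquiv (b,q.1)) q.2).prod`;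
the degree-`K` flat family `𝔉_K` = patterns exciting exactly `K` blocks, `|𝔉_K| = C(t,K)·8^K`.
* deficiency (`stub_normalOrder` + `stub_filterCard`): every degree-`K` Majorana monomial image of an `r`-term
  Gaussian combination lies in ONE subspace of dimension `≤ r · D_K(n)`;
* fullness (`stub_flatOrthoOfInvariant` + `stub_magicInvariant`): the flat-family images of `|M⟩^{⊗t}` are orthonormal;
* mass bound (landed): `|ι| − dim W ≤ |ι| · ‖ψ − φ‖²`;
* counting (`stub_countGap`): `∀ c ∃ t K, 2 (t^c + c) · D_K(4t) < |𝔉_K|`.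
Composition (`NegApproxGaussRankSuperpoly_of_parts`, sorry-free): δ := 1/2; `|𝔉_K| − dim W ≤ |𝔉_K| ‖M^{⊗t} − φ‖²`
with `2 dim W ≤ 2 r D_K < |𝔉_K|` gives `‖M^{⊗t} − φ‖² > 1/2 > (1/2)²`.
-/

noncomputable section

namespace Summit.QuantumAdvantage.QuantumAdvantage.Theorems.SpinorFlattening

open Matrix Finset
open Literature.Computability.QuantumComplexity Literature.Computability.Cryptography

/-! ## Composition (sorry-free; the six stubs are imported from their landed files) -/

/-- **deficiency** (the former `stub_deficiency`, composed from `stub_normalOrder` and `stub_filterCard`):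
NORMAL-ORDERING DEFICIENCY of the Clifford-multiplication flattening on `r`-term Gaussian combinations —
for Gaussian `g₁ … g_r` on `n` qubits and any coefficients there is ONE subspace `W`, `dim W ≤ r · D_K(n)`,
containing `c_{p₁} ⋯ c_{p_K} (Σ aᵢ gᵢ)` for EVERY list `[p₁, …, p_K]` of `K` Majorana labels.
(`W` = the span of all sorted complement words of all `gᵢ`; `dim ≤ r · #index set`.) -/
theorem deficiency_of_parts (hN : type_of% stub_normalOrder) (hC : type_of% stub_filterCard) :
    ∀ (n K r : ℕ) (a : Fin r → ℂ) (g : Fin r → QReg n → ℂ), (∀ i, IsGaussian (g i)) →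
      ∃ W : Submodule ℂ (QReg n → ℂ), Module.finrank ℂ W ≤ r * flatteningDeficiency K n ∧
        ∀ l : List (Fin n × Bool), l.length = K →
          (l.map fun p => majorana n p.1 p.2).prod *ᵥ (∑ i, a i • g i) ∈ W := by
  intro n K r a g hg
  classical
  choose u hu using fun i => hN n K (g i) (hg i)
  let ι : Type := {I : Finset (Fin n) // I.card ≤ K ∧ I.card % 2 = K % 2}
  let f : Fin r → ι → (QReg n → ℂ) := fun i I =>
    ((I.1.sort (· ≤ ·)).map fun j => ∑ p : Fin n × Bool, u i j p • majorana n p.1 p.2).prod *ᵥ g i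
  let F : Fin r × ι → (QReg n → ℂ) := fun x => f x.1 x.2
  refine ⟨Submodule.span ℂ (Set.range F), ?_, ?_⟩
  · calc Module.finrank ℂ (Submodule.span ℂ (Set.range F)) ≤ Fintype.card (Fin r × ι) :=
          finrank_range_le_card F
      _ = r * flatteningDeficiency K n := by rw [Fintype.card_prod, Fintype.card_fin, hC]
  · intro l hl
    rw [Matrix.mulVec_sum]
    refine Submodule.sum_mem _ fun i _ => ?_
    rw [Matrix.mulVec_smul]
    refine Submodule.smul_mem _ _ ?_
    have hsub : Submodule.span ℂ (Set.range (f i)) ≤ Submodule.span ℂ (Set.range F) :=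
      Submodule.span_mono (by
        rintro _ ⟨I, rfl⟩
        exact ⟨(i, I), rfl⟩)
    exact hsub (hu i l hl)

/-- **deficiency** — the former registered `stub_deficiency`, now a theorem modulo the two new stubs. -/
theorem deficiency :
    ∀ (n K r : ℕ) (a : Fin r → ℂ) (g : Fin r → QReg n → ℂ), (∀ i, IsGaussian (g i)) →
      ∃ W : Submodule ℂ (QReg n → ℂ), Module.finrank ℂ W ≤ r * flatteningDeficiency K n ∧
        ∀ l : List (Fin n × Bool), l.length = K →
          (l.map fun p => majorana n p.1 p.2).prod *ᵥ (∑ i, a i • g i) ∈ W :=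
  deficiency_of_parts stub_normalOrder stub_filterCard

/-- **flatOrthonormal** (the former `stub_flatOrthonormal`, composed from `stub_flatOrthoOfInvariant` and
`stub_magicInvariant`): the flat-family images of `|M⟩^{⊗ t}` are ORTHONORMAL, over all block patterns. -/
theorem flatOrthonormal_of_parts (hI : type_of% stub_flatOrthoOfInvariant) (hM : type_of% stub_magicInvariant) :
    ∀ (t : ℕ) (mono : (Fin t → Option (Fin 4 × Bool)) → Matrix (QReg (t * 4)) (QReg (t * 4)) ℂ),
      (∀ s, mono s = ((List.finRange t).filterMap fun b =>
          (s b).map fun q => majorana (t * 4) (finProdFinEquiv (b, q.1)) q.2).prod) →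
      (∀ s, star (mono s *ᵥ magicMPow t) ⬝ᵥ (mono s *ᵥ magicMPow t) = 1) ∧
        ∀ s s', s ≠ s' → star (mono s *ᵥ magicMPow t) ⬝ᵥ (mono s' *ᵥ magicMPow t) = 0 := by
  intro t mono hmono
  obtain ⟨hX, hZ, h1⟩ := hM t
  exact hI t mono hmono (magicMPow t) hX hZ h1

/-- **flatOrthonormal** — the former registered `stub_flatOrthonormal`, now a theorem modulo the two new stubs. -/
theorem flatOrthonormal :
    ∀ (t : ℕ) (mono : (Fin t → Option (Fin 4 × Bool)) → Matrix (QReg (t * 4)) (QReg (t * 4)) ℂ),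
      (∀ s, mono s = ((List.finRange t).filterMap fun b =>
          (s b).map fun q => majorana (t * 4) (finProdFinEquiv (b, q.1)) q.2).prod) →
      (∀ s, star (mono s *ᵥ magicMPow t) ⬝ᵥ (mono s *ᵥ magicMPow t) = 1) ∧
        ∀ s s', s ≠ s' → star (mono s *ᵥ magicMPow t) ⬝ᵥ (mono s' *ᵥ magicMPow t) = 0 :=
  flatOrthonormal_of_parts stub_flatOrthoOfInvariant stub_magicInvariant

/-- The labels excited by a block pattern have as many entries as there are excited blocks. -/
theorem length_filterMap_labels (t : ℕ) (s : Fin t → Option (Fin 4 × Bool)) :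
    ((List.finRange t).filterMap fun b =>
        (s b).map fun q => ((finProdFinEquiv (b, q.1) : Fin (t * 4)), q.2)).length =
      (univ.filter fun b => (s b).isSome).card := by
  classical
  have key : ∀ L : List (Fin t), (L.filterMap fun b =>
      (s b).map fun q => ((finProdFinEquiv (b, q.1) : Fin (t * 4)), q.2)).length =
        (L.filter fun b => (s b).isSome).length := by
    intro L
    induction L with
    | nil => simp
    | cons b L ih =>
      cases hb : s b with
      | none => simp [hb, ih]
      | some q => simp [hb, ih]
  rw [key, ← List.toFinset_card_of_nodup ((List.nodup_finRange t).filter _)]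
  congr 1
  ext b
  simp

/-- **The composition over the four part STATEMENTS**: deficiency → fullness → mass bound → count → the crux,
over the tree's named API (`IsGaussian`, `magicMPow`, `normSq`). `δ := 1/2`. -/
theorem NegApproxGaussRankSuperpoly_of_parts (hD : type_of% deficiency)
    (hO : type_of% flatOrthonormal) (hB : type_of% stub_massBound) (hC : type_of% stub_countGap) :
    ∃ δ : ℝ, 0 < δ ∧ δ < 1 ∧ ∀ c : ℕ, ∃ t : ℕ, ∀ r : ℕ, r ≤ t ^ c + c →
      ∀ (a : Fin r → ℂ) (g : Fin r → QReg (t * 4) → ℂ), (∀ i, IsGaussian (g i)) →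
        δ ^ 2 < normSq (magicMPow t - ∑ i, a i • g i) := by
  classical
  refine ⟨1 / 2, by norm_num, by norm_num, fun c => ?_⟩
  obtain ⟨t, K, hcount⟩ := hC c
  refine ⟨t, fun r hr a g hg => ?_⟩
  -- the flat family: labels, monomials, index type
  let lab : (Fin t → Option (Fin 4 × Bool)) → List (Fin (t * 4) × Bool) := fun s =>
    (List.finRange t).filterMap fun b => (s b).map fun q => (finProdFinEquiv (b, q.1), q.2)
  let mono : (Fin t → Option (Fin 4 × Bool)) → Matrix (QReg (t * 4)) (QReg (t * 4)) ℂ := fun s =>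
    ((List.finRange t).filterMap fun b =>
      (s b).map fun q => majorana (t * 4) (finProdFinEquiv (b, q.1)) q.2).prod
  have hmono_lab : ∀ s, mono s = ((lab s).map fun p => majorana (t * 4) p.1 p.2).prod := by
    intro s
    simp only [mono, lab, List.map_filterMap, Option.map_map]
    rfl
  let ι : Type := {s : Fin t → Option (Fin 4 × Bool) // (univ.filter fun b => (s b).isSome).card = K}
  -- deficiency: one subspace W of dimension ≤ r·D_K(4t) holds every degree-K monomial image of φ
  obtain ⟨W, hW, hmem⟩ := hD (t * 4) K r a g hg
  -- unitarity of the monomials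
  have hunit : ∀ s, mono s ∈ Matrix.unitaryGroup (QReg (t * 4)) ℂ := by
    intro s
    rw [hmono_lab]
    refine list_prod_mem ?_
    intro x hx
    obtain ⟨p, -, rfl⟩ := List.mem_map.1 hx
    exact majorana_mem_unitaryGroup _ _ _
  -- orthonormality of the images of M^{⊗t}
  obtain ⟨hO1, hO2⟩ := hO t mono (fun s => rfl)
  -- mass bound for the degree-K family
  have hmass := hB (t * 4) ι (fun s => mono s.1) (magicMPow t) (∑ i, a i • g i) W
    (fun s => hunit s.1) (fun s => hO1 s.1)
    (fun s s' hss' => hO2 s.1 s'.1 fun h => hss' (Subtype.ext h))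
    (fun s => by
      show mono s.1 *ᵥ _ ∈ W
      rw [hmono_lab]
      exact hmem (lab s.1) ((length_filterMap_labels t s.1).trans s.2))
  -- counting: 2 · dim W ≤ 2 r D ≤ 2 (t^c + c) D < |𝔉_K|
  have hfin : 2 * Module.finrank ℂ W < Fintype.card ι :=
    calc 2 * Module.finrank ℂ W ≤ 2 * ((t ^ c + c) * flatteningDeficiency K (t * 4)) :=
          Nat.mul_le_mul_left 2 (hW.trans (Nat.mul_le_mul_right _ hr))
      _ = 2 * (t ^ c + c) * flatteningDeficiency K (t * 4) := (Nat.mul_assoc _ _ _).symm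
      _ < Fintype.card ι := hcount
  have hfinR : (2 : ℝ) * (Module.finrank ℂ W : ℝ) < (Fintype.card ι : ℝ) := by
    exact_mod_cast hfin
  have hpos : (0 : ℝ) < (Fintype.card ι : ℝ) := by
    have : 0 < Fintype.card ι := by omega
    exact_mod_cast this
  have key : (Fintype.card ι : ℝ) * (1 / 2) < (Fintype.card ι : ℝ) * normSq (magicMPow t - ∑ i, a i • g i) := by
    linarith
  have hx : (1 / 2 : ℝ) < normSq (magicMPow t - ∑ i, a i • g i) :=
    lt_of_mul_lt_mul_left key hpos.le
  calc (1 / 2 : ℝ) ^ 2 < 1 / 2 := by norm_num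
    _ < _ := hx

/-- **The skeleton concludes the crux BY NAME**: `SpinorFlattening.NegApproxGaussRankSuperpoly`
(stmt-QuantumAdvantage-1245) from the registered stubs (via `deficiency`, `flatOrthonormal`), the landed
`stub_massBound` and `stub_countGap`; the route's inline `maj`/`IsGauss`/`Mpow` are definitionally the tree's
`majorana`/`IsGaussian`/`magicMPow`, so the named-API composition is accepted by `exact`. -/
theorem NegApproxGaussRankSuperpoly_of :
    Summit.QuantumAdvantage.QuantumAdvantage.Theses.SpinorFlattening.NegApproxGaussRankSuperpoly :=
  NegApproxGaussRankSuperpoly_of_parts deficiency flatOrthonormal stub_massBound stub_countGap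

end Summit.QuantumAdvantage.QuantumAdvantage.Theorems.SpinorFlattening

end
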